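import Literature.Geometry.Riemannian.HeatKernelBootstrapStep
import Literature.Geometry.Riemannian.HeatKernelFnUpperBound
import Literature.Geometry.Riemannian.KernelNashEntropyUpperBound
import Literature.Analysis.Calculus.DyadicBootstrap
import HarnessLib

/-!
# Bamler's upper heat kernel bound (Bamler 2020a, Thm. 7.1)

R. Bamler, *Entropy and heat kernel bounds on a Ricci flow background*, arXiv:2008.07093 (2020a),
§7.1, Thm. 7.1 (arXiv v1 Thm. 24): *"If `[s,t] ⊂ I` and `R ≥ R_min` on `M × [s,t]`, then
`K(x,t;y,s) ≤ C(R_min(t−s)) (t−s)^{-n/2} exp(−𝒩_{x,t}(t−s))`."* Proved here for the conjugate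
heat kernel `heatKernelFn` of a Ricci flow on a closed connected manifold modelled on `ℝᵐ`
(`m ≥ 3`), with a constant depending only on `m` and an upper bound `Λ` for `−R_min(t−s)`
(`exists_heatKernelFn_le_rpow_mul_exp_neg_kernelNashEntropy`): the one-step recursion of
`HeatKernelBootstrapStep.lean` for `G(τ) = sup_x τ^{m/2} e^{𝒩*_s(x,s+τ)} K(x,s+τ;y,s)`, the
a-priori flow-dependent bound `IsRicciFlow.exists_apriori_heatKernelFn_le` (from
`K ≤ C(t−s)^{-m/2}` and the Jensen bound on `𝒩`), the choice `A = 3·4^{m+2}`, `ρ` small by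
continuity of the explicit coefficients, and the dyadic bootstrap
`Literature.Analysis.Calculus.dyadicBootstrap_le`. What is NOT here: the dependence
`C(R_min(t−s)) = C₀ (n − R_min(t−s))^{n/2}` of the printed Claim, the Gaussian refinements
Thm. 7.2 and the gradient bound Thm. 7.5.

## References

* R. H. Bamler, *Entropy and heat kernel bounds on a Ricci flow background*, arXiv:2008.07093
  (2020), §7.1–7.2, Thm. 7.1 and its proof. [Bamler2020Entropy]
-/

noncomputable section

open Set Filter Function MeasureTheory Measure
open scoped Manifold ContDiff Topology ENNReal NNReal

namespace Literature.Geometry.Riemannian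

open Lorentzian Lorentzian.PseudoRiemannianMetric

section UpperBound

variable {m : ℕ} {M : Type*} [TopologicalSpace M] [ChartedSpace (EuclideanSpace ℝ (Fin m)) M]
  [IsManifold 𝓘(ℝ, EuclideanSpace ℝ (Fin m)) ∞ M] [T2Space M] [CompactSpace M]
  [SecondCountableTopology M] [MeasurableSpace M] [BorelSpace M] [ConnectedSpace M]
  {h : ℝ → PseudoRiemannianMetric 𝓘(ℝ, EuclideanSpace ℝ (Fin m)) ∞ (EuclideanSpace ℝ (Fin m))
    (TangentSpace 𝓘(ℝ, EuclideanSpace ℝ (Fin m)) : M → Type _)}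
  {cov : ℝ → CovariantDerivative 𝓘(ℝ, EuclideanSpace ℝ (Fin m)) (EuclideanSpace ℝ (Fin m))
    (TangentSpace 𝓘(ℝ, EuclideanSpace ℝ (Fin m)) : M → Type _)}
  {a T : ℝ} (hh : IsContMDiffFamilyOn ∞ h univ) (hR : ∀ r, (h r).IsRiemannian)

/-- Unfolding the inductive quantity: from `τ^{m/2} e^{N} K ≤ Z` to `K ≤ Z τ^{-m/2} e^{-N}`.
[folklore] -/
theorem le_mul_rpow_neg_mul_exp_neg_of_le {τ N K Z : ℝ} {p : ℝ} (hτ : 0 < τ)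
    (hle : τ ^ p * Real.exp N * K ≤ Z) : K ≤ Z * τ ^ (-p) * Real.exp (-N) := by
  have h1 : 0 < τ ^ p := Real.rpow_pos_of_pos hτ p
  have h2 : 0 < Real.exp N := Real.exp_pos N
  have h3 : K = (τ ^ p * Real.exp N * K) * (τ ^ (-p) * Real.exp (-N)) := by
    rw [Real.rpow_neg hτ.le, Real.exp_neg]
    field_simp
  rw [h3, ← mul_assoc]
  exact mul_le_mul_of_nonneg_right (mul_le_mul_of_nonneg_right hle (Real.rpow_nonneg hτ.le _))
    (Real.exp_pos _).le

/-- **The a-priori (flow-dependent) bound anchoring the bootstrap** (Bamler 2020a, §7.2: "such a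
bound holds for some large `Z`, which may depend on the underlying Ricci flow"): for fixed `s`
and pole `y`, `τ^{m/2} e^{𝒩*_s(x,s+τ)} K(x,s+τ;y,s) ≤ A' τ^{-m/2}` for all `x` and
`τ ∈ (0, T − s]`, from `K ≤ C (t−s)^{-m/2}` (`IsRicciFlow.exists_heatKernelFn_le`) and the Jensen
bound `𝒩 ≤ log|M|_{g_s} − (m/2) log(4πτ) − m/2` (`kernelNashEntropy_le_log_measureReal`).
[cite: Bamler2020Entropy, §7.2, proof of Thm. 7.1] -/
theorem IsRicciFlow.exists_apriori_heatKernelFn_le (hflow : IsRicciFlow h cov (Icc a T))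
    (hm : 3 ≤ m) {s : ℝ} (has : a < s) (hsT : s < T) (y : M) :
    ∃ A' : ℝ, 0 ≤ A' ∧ ∀ τ ∈ Ioc 0 (T - s), ∀ x : M,
      τ ^ ((m : ℝ) / 2) * Real.exp (pointedNashEntropy h
          (fun r v ↦ hflow.heatKernelFn hh hR (s + τ) x (v, r)) m (s + τ) s) *
        hflow.heatKernelFn hh hR (s + τ) x (y, s) ≤ A' * τ ^ (-((m : ℝ) / 2)) := by
  haveI : Nonempty M := ⟨y⟩
  have haT : a < T := has.trans hsT
  obtain ⟨C, hC0, hC⟩ := hflow.exists_heatKernelFn_le hh hR haT hm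
  set V : ℝ := (h s).riemVolume.real univ with hV
  have hVpos : 0 < V := by
    rw [hV, measureReal_def]
    exact ENNReal.toReal_pos (PseudoRiemannianMetric.riemVolume_univ_pos (hR s)).ne'
      (h s).riemVolume_univ_lt_top.ne
  refine ⟨V * (4 * Real.pi) ^ (-((m : ℝ) / 2)) * Real.exp (-(m : ℝ) / 2) * C, by positivity,
    fun τ hτ x ↦ ?_⟩
  have hτ0 : 0 < τ := hτ.1
  have hst : s < s + τ := by linarith
  have htT : s + τ ≤ T := by linarith [hτ.2]
  have hK := hC (s + τ) ⟨has.trans hst, htT⟩ x s ⟨has, hst⟩ y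
  rw [add_sub_cancel_left] at hK
  have hN := kernelNashEntropy_le_log_measureReal hflow hh hR has hst htT x
  rw [add_sub_cancel_left] at hN
  -- `e^{N} ≤ V (4π)^{-m/2} τ^{-m/2} e^{-m/2}`
  have hexpN : Real.exp (pointedNashEntropy h
      (fun r v ↦ hflow.heatKernelFn hh hR (s + τ) x (v, r)) m (s + τ) s) ≤
      V * ((4 * Real.pi) ^ (-((m : ℝ) / 2)) * τ ^ (-((m : ℝ) / 2))) * Real.exp (-(m : ℝ) / 2) := by
    refine (Real.exp_le_exp.2 hN).trans (le_of_eq ?_)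
    rw [Real.exp_sub, Real.exp_sub, Real.exp_log hVpos]
    have h4 : 0 < 4 * Real.pi * τ := by positivity
    rw [show (m : ℝ) / 2 * Real.log (4 * Real.pi * τ) = Real.log ((4 * Real.pi * τ) ^ ((m : ℝ) / 2))
      by rw [Real.log_rpow h4], Real.exp_log (Real.rpow_pos_of_pos h4 _),
      Real.mul_rpow (by positivity) hτ0.le, Real.rpow_neg (by positivity), Real.rpow_neg hτ0.le,
      neg_div, Real.exp_neg]
    field_simp
  have hP0 : 0 ≤ τ ^ ((m : ℝ) / 2) := Real.rpow_nonneg hτ0.le _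
  calc τ ^ ((m : ℝ) / 2) * Real.exp (pointedNashEntropy h
          (fun r v ↦ hflow.heatKernelFn hh hR (s + τ) x (v, r)) m (s + τ) s) *
        hflow.heatKernelFn hh hR (s + τ) x (y, s)
      ≤ τ ^ ((m : ℝ) / 2) * (V * ((4 * Real.pi) ^ (-((m : ℝ) / 2)) * τ ^ (-((m : ℝ) / 2))) *
          Real.exp (-(m : ℝ) / 2)) * (C * τ ^ (-((m : ℝ) / 2))) := by
        refine mul_le_mul (mul_le_mul_of_nonneg_left hexpN hP0) hK ?_ (by positivity)
        exact (hflow.heatKernelFn_pos hh hR ⟨has.trans hst, htT⟩ x ⟨mem_univ _, has, hst⟩).le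
    _ = V * (4 * Real.pi) ^ (-((m : ℝ) / 2)) * Real.exp (-(m : ℝ) / 2) * C * τ ^ (-((m : ℝ) / 2)) *
          (τ ^ ((m : ℝ) / 2) * τ ^ (-((m : ℝ) / 2))) := by ring
    _ = _ := by rw [Real.rpow_neg hτ0.le, mul_inv_cancel₀ (Real.rpow_pos_of_pos hτ0 _).ne', mul_one]

/-- `√(3 / (3·4^{m+2})) · 2^{m/2} ≤ 1/4`: the choice `A = 3·4^{m+2}` of the ball-radius parameter
makes the limiting contraction factor of the recursion beat the dyadic growth `2^{m/2}` of the
a-priori bound. [folklore] -/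
theorem sqrt_three_div_mul_two_rpow_le (m : ℕ) :
    Real.sqrt (3 / (3 * 4 ^ (m + 2))) * (2 : ℝ) ^ ((m : ℝ) / 2) ≤ 1 / 4 := by
  have h4 : (4 : ℝ) ^ (m + 2) = (2 ^ (m + 2)) ^ 2 := by
    rw [← pow_mul, mul_comm, pow_mul]; norm_num
  have hsq : Real.sqrt (3 / (3 * 4 ^ (m + 2))) = 1 / 2 ^ (m + 2) := by
    have e : (3 : ℝ) / (3 * 4 ^ (m + 2)) = 1 / (2 ^ (m + 2)) ^ 2 := by
      rw [h4]; field_simp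
    rw [e, Real.sqrt_div zero_le_one, Real.sqrt_one, Real.sqrt_sq (by positivity)]
  have hrpow : (2 : ℝ) ^ ((m : ℝ) / 2) ≤ (2 : ℝ) ^ m := by
    have := Real.rpow_le_rpow_of_exponent_le (x := (2 : ℝ)) (by norm_num)
      (by linarith [(Nat.cast_nonneg m : (0 : ℝ) ≤ m)] : (m : ℝ) / 2 ≤ (m : ℝ))
    rwa [Real.rpow_natCast] at this
  have h22 : (2 : ℝ) ^ (m + 2) = 2 ^ m * 4 := by rw [pow_add]; norm_num
  rw [hsq, h22]
  calc 1 / ((2 : ℝ) ^ m * 4) * (2 : ℝ) ^ ((m : ℝ) / 2) ≤ 1 / ((2 : ℝ) ^ m * 4) * (2 : ℝ) ^ m :=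
        mul_le_mul_of_nonneg_left hrpow (by positivity)
    _ = 1 / 4 := by field_simp

/-- **Bamler 2020a, Thm. 7.1 (arXiv v1 Thm. 24): the pointwise upper heat kernel bound in terms of
the pointed Nash entropy.** For every dimension `m ≥ 3` and `Λ ≥ 0` there is `C = C(m, Λ) < ∞`
such that for every Ricci flow `hflow = (h, cov)` on `[a, T]` of a `C^∞` family of Riemannian
metrics on a closed connected manifold modelled on `ℝᵐ`, all `a < s < t < T` with `R ≥ R_min` on
`M × [s, t]` and `−R_min (t − s) ≤ Λ`, and all `x, y`,

  `K(x, t; y, s) ≤ C (t − s)^{-m/2} exp(−𝒩*_s(x, t))`, `𝒩*_s(x,t) = 𝒩_{x,t}(t − s)`.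

("If `[s,t] ⊂ I` and `R ≥ R_min` on `M × [s,t]`, then
`K(x,t;y,s) ≤ C(R_min(t−s)) (t−s)^{-n/2} exp(−𝒩_{x,t}(t−s))`".) Proof: the fixed-scale recursion
`IsRicciFlow.heatKernelFn_bootstrap_step` for `G(τ) = sup_x τ^{m/2} e^{𝒩*_s(x,s+τ)} K(x,s+τ;y,s)`
with `A = 3·4^{m+2}` and `ρ` small (chosen by continuity of the explicit coefficients at `ρ = 0`,
where the contraction factor tends to `√(3/A) 2^{m/2} ≤ 1/4`), anchored by the flow-dependent
a-priori bound `IsRicciFlow.exists_apriori_heatKernelFn_le` and closed by the dyadic bootstrap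
`Literature.Analysis.Calculus.dyadicBootstrap_le`. The strict inequality `t < T` is inherited
from the base-point regularity of the tree's heat kernel.
[cite: Bamler2020Entropy, §7.1, Thm. 7.1 (arXiv v1 Thm. 24)] -/
theorem exists_heatKernelFn_le_rpow_mul_exp_neg_kernelNashEntropy (m : ℕ) (hm : 3 ≤ m) {Λ : ℝ}
    (hΛ : 0 ≤ Λ) :
    ∃ C : ℝ, 0 < C ∧ ∀ {M : Type*} [TopologicalSpace M] [ChartedSpace (EuclideanSpace ℝ (Fin m)) M]
      [IsManifold 𝓘(ℝ, EuclideanSpace ℝ (Fin m)) ∞ M] [T2Space M] [CompactSpace M]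
      [SecondCountableTopology M] [MeasurableSpace M] [BorelSpace M] [ConnectedSpace M]
      {h : ℝ → PseudoRiemannianMetric 𝓘(ℝ, EuclideanSpace ℝ (Fin m)) ∞ (EuclideanSpace ℝ (Fin m))
        (TangentSpace 𝓘(ℝ, EuclideanSpace ℝ (Fin m)) : M → Type _)}
      {cov : ℝ → CovariantDerivative 𝓘(ℝ, EuclideanSpace ℝ (Fin m)) (EuclideanSpace ℝ (Fin m))
        (TangentSpace 𝓘(ℝ, EuclideanSpace ℝ (Fin m)) : M → Type _)}
      {a T : ℝ} (hflow : IsRicciFlow h cov (Icc a T)) (hh : IsContMDiffFamilyOn ∞ h univ)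
      (hR : ∀ r, (h r).IsRiemannian),
      ∀ {s t : ℝ}, a < s → s < t → t < T → ∀ {Rmin : ℝ},
      (∀ r ∈ Icc s t, ∀ z : M, Rmin ≤ (h r).scalarCurvatureWith (cov r) z) →
      -Rmin * (t - s) ≤ Λ → ∀ x y : M,
      hflow.heatKernelFn hh hR t x (y, s) ≤ C * (t - s) ^ (-(m : ℝ) / 2) *
        Real.exp
          (-(pointedNashEntropy h (fun r v ↦ hflow.heatKernelFn hh hR t x (v, r)) m t s)) := by
  /- ── universal constants: `H = H_m`, `A = 3·4^{m+2}`, the coefficient functions of `ρ` ── -/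
  set Hm : ℝ := ((m : ℝ) - 1) * Real.pi ^ 2 / 2 + 4 with hHm
  set A : ℝ := 3 * 4 ^ (m + 2) with hA
  have hA2 : (2 : ℝ) ≤ A := by
    rw [hA]
    have : (1 : ℝ) ≤ 4 ^ (m + 2) := one_le_pow₀ (by norm_num)
    linarith
  set θ₁f : ℝ → ℝ := fun ρ ↦ (1 - ρ ^ 2) ^ (-(m : ℝ) / 2) *
      Real.exp (Real.sqrt ((m : ℝ) + Λ) * ρ * Real.sqrt Hm) * Real.sqrt (3 / A) *
      Real.exp (16 * (((m : ℝ) + Λ) * ρ ^ 2) + Real.sqrt (2 * Hm) * (Real.sqrt ((m : ℝ) + Λ) * ρ))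
    with hθ₁f
  set θ₂f : ℝ → ℝ := fun ρ ↦ 2 * Real.sqrt (A * Hm) *
      Real.exp ((Real.sqrt ((m : ℝ) + Λ) * Real.sqrt Hm +
        3 * Real.sqrt ((m : ℝ) + Λ) * Real.sqrt (A * Hm)) * ρ) *
      Real.sqrt (2 ^ (m + 2) * 3 * Real.exp (4 * Real.sqrt ((m : ℝ) + Λ) * Real.sqrt Hm +
        16 * ((m : ℝ) + Λ))) * ρ with hθ₂f
  set g : ℝ → ℝ := fun ρ ↦ (θ₁f ρ + θ₂f ρ) * (2 : ℝ) ^ ((m : ℝ) / 2) with hg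
  -- continuity of `g` at `ρ = 0` and `g 0 ≤ 1/4`
  have hg_cont : ContinuousAt g 0 := by
    have h1 : ContinuousAt (fun ρ : ℝ ↦ (1 - ρ ^ 2) ^ (-(m : ℝ) / 2)) 0 :=
      ((continuous_const.sub (continuous_pow 2)).continuousAt).rpow_const (Or.inl (by norm_num))
    have he1 : Continuous fun ρ : ℝ ↦ Real.exp (Real.sqrt ((m : ℝ) + Λ) * ρ * Real.sqrt Hm) := by
      fun_prop
    have he2 : Continuous fun ρ : ℝ ↦ Real.exp (16 * (((m : ℝ) + Λ) * ρ ^ 2) +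
        Real.sqrt (2 * Hm) * (Real.sqrt ((m : ℝ) + Λ) * ρ)) := by fun_prop
    have h3 : Continuous θ₂f := by rw [hθ₂f]; fun_prop
    have h13 : ContinuousAt θ₁f 0 := by
      rw [hθ₁f]
      exact ((h1.mul he1.continuousAt).mul continuousAt_const).mul he2.continuousAt
    exact (h13.add h3.continuousAt).mul continuousAt_const
  have hg0 : g 0 ≤ 1 / 4 := by
    have e : g 0 = Real.sqrt (3 / A) * (2 : ℝ) ^ ((m : ℝ) / 2) := by
      simp [hg, hθ₁f, hθ₂f]
    rw [e, hA]
    exact_mod_cast sqrt_three_div_mul_two_rpow_le m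
  -- choose `ρ₀ ∈ (0, 1/2]` with contraction factor `< 1`
  obtain ⟨ρ₀, hρ₀, hρ₀2, hcontr⟩ : ∃ ρ₀ : ℝ, 0 < ρ₀ ∧ ρ₀ ≤ 1 / 2 ∧ g ρ₀ < 1 := by
    have hev : ∀ᶠ ρ in 𝓝 (0 : ℝ), g ρ < 1 :=
      (hg_cont.tendsto).eventually_lt_const (by linarith)
    obtain ⟨ε, hε, hball⟩ := Metric.eventually_nhds_iff.1 hev
    refine ⟨min (ε / 2) (1 / 2), by positivity, min_le_right _ _, hball ?_⟩
    rw [Real.dist_eq, sub_zero, abs_of_pos (by positivity)]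
    exact (min_le_left _ _).trans_lt (by linarith)
  set θ₁ : ℝ := θ₁f ρ₀ with hθ₁
  set θ₂ : ℝ := θ₂f ρ₀ with hθ₂
  set E₁ : ℝ := 2 * Real.exp Λ * (4 * Real.pi) ^ (-(m : ℝ) / 2) * Real.exp (-(m : ℝ) / 2) *
      Real.exp (2 * Real.sqrt ((m : ℝ) + Λ)) * ρ₀ ^ (-(m : ℝ)) with hE₁
  have hρsq : ρ₀ ^ 2 ≤ 1 / 4 := by
    have := pow_le_pow_left₀ hρ₀.le hρ₀2 2; norm_num at this; exact this
  have hlam : 1 / 2 ≤ 1 - ρ₀ ^ 2 := by linarith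
  have hlam1 : 1 - ρ₀ ^ 2 ≤ 1 := by nlinarith only [sq_nonneg ρ₀]
  have hlam0 : 0 < 1 - ρ₀ ^ 2 := by linarith
  have hθ₁0 : 0 ≤ θ₁ := by
    simp only [hθ₁, hθ₁f]
    exact mul_nonneg (mul_nonneg (mul_nonneg (Real.rpow_nonneg hlam0.le _) (Real.exp_pos _).le)
      (Real.sqrt_nonneg _)) (Real.exp_pos _).le
  have hθ₂0 : 0 ≤ θ₂ := by
    simp only [hθ₂, hθ₂f]
    exact mul_nonneg (by positivity) hρ₀.le
  have hE₁0 : 0 < E₁ := by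
    rw [hE₁]
    exact mul_pos (mul_pos (mul_pos (mul_pos (mul_pos two_pos (Real.exp_pos _))
      (Real.rpow_pos_of_pos (by positivity) _)) (Real.exp_pos _)) (Real.exp_pos _))
      (Real.rpow_pos_of_pos hρ₀ _)
  have hcontr' : (θ₁ + θ₂) * (2 : ℝ) ^ ((m : ℝ) / 2) < 1 := by simpa [hg, hθ₁, hθ₂] using hcontr
  have hθlt : θ₁ + θ₂ < 1 := by
    have h2 : (1 : ℝ) ≤ (2 : ℝ) ^ ((m : ℝ) / 2) := Real.one_le_rpow (by norm_num) (by positivity)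
    nlinarith only [hcontr', h2, hθ₁0, hθ₂0]
  refine ⟨E₁ / (1 - (θ₁ + θ₂)), div_pos hE₁0 (by linarith), ?_⟩
  /- ── the flow ── -/
  intro M _ _ _ _ _ _ _ _ _ h cov a T hflow hh hR s t has hst htT Rmin hRmin hRΛ x y
  haveI : Nonempty M := ⟨x⟩
  have hm0 : 0 < m := by omega
  set τ₀ : ℝ := t - s with hτ₀
  have hτ₀0 : 0 < τ₀ := by rw [hτ₀]; linarith
  have hτ₀T : τ₀ < T - s := by rw [hτ₀]; linarith
  -- the inductive quantity and its supremum over the base point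
  set F : M → ℝ → ℝ := fun z τ ↦ τ ^ ((m : ℝ) / 2) * Real.exp (pointedNashEntropy h
      (fun r v ↦ hflow.heatKernelFn hh hR (s + τ) z (v, r)) m (s + τ) s) *
    hflow.heatKernelFn hh hR (s + τ) z (y, s) with hF
  set G : ℝ → ℝ := fun τ ↦ ⨆ z, F z τ with hG
  obtain ⟨A', hA'0, hA'⟩ := hflow.exists_apriori_heatKernelFn_le hh hR hm has (hst.trans htT) y
  have hF_le_G : ∀ τ ∈ Ioc 0 (T - s), ∀ z, F z τ ≤ G τ := fun τ hτ z ↦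
    le_ciSup (f := fun z ↦ F z τ) ⟨A' * τ ^ (-((m : ℝ) / 2)), by
      rintro _ ⟨z', rfl⟩; exact hA' τ hτ z'⟩ z
  have hG_le : ∀ τ B, (∀ z, F z τ ≤ B) → G τ ≤ B := fun τ B hB ↦ ciSup_le hB
  have hF0 : ∀ τ ∈ Ioc 0 (T - s), ∀ z, 0 ≤ F z τ := by
    intro τ hτ z
    have ht' : s + τ ∈ Ioc a T := ⟨by linarith [hτ.1], by linarith [hτ.2]⟩
    have hK := (hflow.heatKernelFn_pos hh hR ht' z (p := (y, s))
      ⟨mem_univ _, has, by linarith [hτ.1]⟩).le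
    simp only [hF]
    exact mul_nonneg (mul_nonneg (Real.rpow_nonneg hτ.1.le _) (Real.exp_pos _).le) hK
  have hG0 : ∀ τ ∈ Ioc 0 (T - s), 0 ≤ G τ := fun τ hτ ↦ (hF0 τ hτ x).trans (hF_le_G τ hτ x)
  have hapr : ∀ τ ∈ Ioc 0 τ₀, G τ ≤ A' * τ ^ (-((m : ℝ) / 2)) := fun τ hτ ↦
    hG_le τ _ (hA' τ ⟨hτ.1, hτ.2.trans hτ₀T.le⟩)
  -- the recursion
  have hrec : ∀ τ ∈ Ioc 0 τ₀, G τ ≤ E₁ + θ₁ * G ((1 - ρ₀ ^ 2) * τ) + θ₂ * G (τ / 2) := by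
    intro τ hτ
    have hτ0 : 0 < τ := hτ.1
    have hτT' : s + τ < T := by linarith [hτ.2]
    have hRmin' : ∀ r ∈ Icc s (s + τ), ∀ z : M, Rmin ≤ (h r).scalarCurvatureWith (cov r) z :=
      fun r hr z ↦ hRmin r ⟨hr.1, hr.2.trans (by linarith [hτ.2])⟩ z
    have hRΛ' : -Rmin * τ ≤ Λ := by
      rcases le_or_gt 0 Rmin with hR0 | hR0
      · exact (mul_nonpos_of_nonpos_of_nonneg (neg_nonpos.2 hR0) hτ0.le).trans hΛ
      · have : -Rmin * τ ≤ -Rmin * (t - s) :=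
          mul_le_mul_of_nonneg_left hτ.2 (by linarith)
        exact this.trans hRΛ
    have hsub₁ : (1 - ρ₀ ^ 2) * τ ∈ Ioc 0 (T - s) :=
      ⟨mul_pos hlam0 hτ0, (mul_le_of_le_one_left hτ0.le hlam1).trans (hτ.2.trans hτ₀T.le)⟩
    have hsub₂ : τ / 2 ∈ Ioc 0 (T - s) := ⟨by positivity, by linarith [hτ.2]⟩
    have HZ₁ : ∀ w : M, hflow.heatKernelFn hh hR (s + (1 - ρ₀ ^ 2) * τ) w (y, s) ≤
        G ((1 - ρ₀ ^ 2) * τ) * ((1 - ρ₀ ^ 2) * τ) ^ (-(m : ℝ) / 2) *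
          Real.exp (-(pointedNashEntropy h
            (fun r v ↦ hflow.heatKernelFn hh hR (s + (1 - ρ₀ ^ 2) * τ) w (v, r)) m
            (s + (1 - ρ₀ ^ 2) * τ) s)) := by
      intro w
      have h1 := hF_le_G _ hsub₁ w
      have h2 := le_mul_rpow_neg_mul_exp_neg_of_le (p := (m : ℝ) / 2) hsub₁.1 h1
      rwa [← neg_div] at h2
    have HZ₂ : ∀ z : M, hflow.heatKernelFn hh hR (s + τ / 2) z (y, s) ≤
        G (τ / 2) * (τ / 2) ^ (-(m : ℝ) / 2) * Real.exp (-(pointedNashEntropy h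
          (fun r w ↦ hflow.heatKernelFn hh hR (s + τ / 2) z (w, r)) m (s + τ / 2) s)) := by
      intro z
      have h1 := hF_le_G _ hsub₂ z
      have h2 := le_mul_rpow_neg_mul_exp_neg_of_le (p := (m : ℝ) / 2) hsub₂.1 h1
      rwa [← neg_div] at h2
    have hstep : ∀ z : M, F z τ ≤ E₁ + θ₂ * G (τ / 2) + θ₁ * G ((1 - ρ₀ ^ 2) * τ) := by
      intro z
      have := hflow.heatKernelFn_bootstrap_step hh hR hm has hτ0 hτT' hρ₀ hρ₀2 hA2 hRmin' hΛ
        hRΛ' y (hG0 _ hsub₁) (hG0 _ hsub₂) HZ₁ HZ₂ z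
      simpa only [hF, hE₁, hθ₁, hθ₂, hθ₁f, hθ₂f] using this
    calc G τ ≤ E₁ + θ₂ * G (τ / 2) + θ₁ * G ((1 - ρ₀ ^ 2) * τ) := hG_le τ _ hstep
      _ = _ := add_right_comm _ _ _
  -- the bootstrap
  have hboot := Literature.Analysis.Calculus.dyadicBootstrap_le hE₁0.le hθ₁0 hθ₂0 hlam hlam1 hA'0
    (by positivity : (0 : ℝ) ≤ (m : ℝ) / 2) hcontr' hapr hrec τ₀ ⟨hτ₀0, le_rfl⟩
  -- conclusion at `(x, t)`
  have hτ₀mem : τ₀ ∈ Ioc 0 (T - s) := ⟨hτ₀0, hτ₀T.le⟩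
  have hFx := (hF_le_G τ₀ hτ₀mem x).trans hboot
  have h2 := le_mul_rpow_neg_mul_exp_neg_of_le (p := (m : ℝ) / 2) hτ₀0 hFx
  rw [← neg_div] at h2
  simpa only [hτ₀, add_sub_cancel] using h2

end UpperBound

end Literature.Geometry.Riemannian

end
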